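import Mathlib

/-!
# The double period of a dominated series is the series of the double periods (support, seat p1)

The last «Fubini» of the geometric side of a two-period identity (memo §2e (a), STATUS l. 14985 (2)(a)): the double
period of the Poincaré-series kernel `K_f(x, y) = Σ_γ f(x⁻¹ γ y)` over `[T_A] × [T_B]` against the characters is
the absolutely convergent sum `Σ_γ O_γ(f)` of the double periods of the single terms. Abstractly, for finite
measures `ν_A`, `ν_B` and a family `F γ : A → B → ℂ` with a UNIFORM summable majorant `‖F γ a b‖ ≤ c γ`:

  `∫_A ∫_B ∑' γ, F γ a b = ∑' γ, ∫_A ∫_B F γ a b`   (`integral_integral_tsum_of_dominated`),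

with `∫_B ∑' γ, F γ a b = ∑' γ, ∫_B F γ a b` for every `a` (`integral_tsum_of_dominated`) and the bound
`‖∫_B F γ a b‖ ≤ c γ · ν_B(B)` (`norm_integral_le_of_dominated`); Mathlib's
`integral_tsum_of_summable_integral_norm` twice. The characters `μ_A(t₁) conj μ_B(t₂)` are absorbed into `F` (they
have modulus one); the majorant is the count × decay bound of the line, uniform on the compact `[T_A] × [T_B]`.

Nothing here is about any group, any double coset, or any period.
Blind lane: Mathlib only; no sorry; axioms ⊆ {propext, Classical.choice, Quot.sound}.
-/

namespace Summit.Ventures.HodgeRepro2.T7SupportDoublePeriodSeries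

open MeasureTheory Filter Topology

variable {Γ A B : Type*} [Countable Γ] [MeasurableSpace A] [MeasurableSpace B] (νA : Measure A)
  (νB : Measure B) [IsFiniteMeasure νA] [IsFiniteMeasure νB]

/-- a uniformly dominated family with a summable majorant -/
def Dominated (F : Γ → A → B → ℂ) (c : Γ → ℝ) : Prop :=
  Summable c ∧ ∀ γ a b, ‖F γ a b‖ ≤ c γ

omit [Countable Γ] [MeasurableSpace A] [IsFiniteMeasure νA] in
/-- a dominated measurable term is integrable on the finite measure -/
theorem integrable_of_dominated {F : Γ → A → B → ℂ} {c : Γ → ℝ} (hd : Dominated F c)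
    (hm : ∀ γ a, AEStronglyMeasurable (F γ a) νB) (γ : Γ) (a : A) : Integrable (F γ a) νB :=
  Integrable.of_bound (hm γ a) (c γ) (Eventually.of_forall fun b => hd.2 γ a b)

omit [Countable Γ] [MeasurableSpace A] [IsFiniteMeasure νA] in
/-- `‖∫_B F γ a b‖ ≤ c γ · ν_B(B)` -/
theorem norm_integral_le_of_dominated {F : Γ → A → B → ℂ} {c : Γ → ℝ} (hd : Dominated F c) (γ : Γ) (a : A) :
    ‖∫ b, F γ a b ∂νB‖ ≤ c γ * (νB Set.univ).toReal := by
  have h := norm_integral_le_of_norm_le_const (μ := νB) (f := F γ a) (C := c γ)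
    (Eventually.of_forall fun b => hd.2 γ a b)
  simpa [Measure.real, mul_comm] using h

omit [Countable Γ] [MeasurableSpace A] [IsFiniteMeasure νA] in
/-- `∫_B ‖F γ a b‖ ≤ c γ · ν_B(B)` -/
theorem integral_norm_le_of_dominated {F : Γ → A → B → ℂ} {c : Γ → ℝ} (hd : Dominated F c) (γ : Γ) (a : A) :
    ∫ b, ‖F γ a b‖ ∂νB ≤ c γ * (νB Set.univ).toReal := by
  have h := norm_integral_le_of_norm_le_const (μ := νB) (f := F γ a) (C := c γ)
    (Eventually.of_forall fun b => hd.2 γ a b)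
  have h2 : ∫ b, ‖F γ a b‖ ∂νB ≤ c γ * (νB Set.univ).toReal := by
    calc ∫ b, ‖F γ a b‖ ∂νB ≤ ∫ _b, c γ ∂νB :=
          integral_mono_of_nonneg (Eventually.of_forall fun b => norm_nonneg _)
            (integrable_const _) (Eventually.of_forall fun b => hd.2 γ a b)
      _ = c γ * (νB Set.univ).toReal := by
          rw [integral_const]
          simp [Measure.real, mul_comm]
  exact h2

omit [MeasurableSpace A] [IsFiniteMeasure νA] in
/-- **the inner interchange**: `∫_B ∑' γ, F γ a b = ∑' γ, ∫_B F γ a b` for every `a` -/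
theorem integral_tsum_of_dominated {F : Γ → A → B → ℂ} {c : Γ → ℝ} (hd : Dominated F c)
    (hm : ∀ γ a, AEStronglyMeasurable (F γ a) νB) (a : A) :
    ∫ b, ∑' γ, F γ a b ∂νB = ∑' γ, ∫ b, F γ a b ∂νB := by
  symm
  refine integral_tsum_of_summable_integral_norm (fun γ => integrable_of_dominated νB hd hm γ a) ?_
  refine (hd.1.mul_right (νB Set.univ).toReal).of_nonneg_of_le (fun γ => integral_nonneg fun b => norm_nonneg _)
    fun γ => integral_norm_le_of_dominated νB hd γ a

/-- **the double interchange**: `∫_A ∫_B ∑' γ, F γ a b = ∑' γ, ∫_A ∫_B F γ a b` -/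
theorem integral_integral_tsum_of_dominated {F : Γ → A → B → ℂ} {c : Γ → ℝ} (hd : Dominated F c)
    (hm : ∀ γ a, AEStronglyMeasurable (F γ a) νB)
    (hmA : ∀ γ, AEStronglyMeasurable (fun a => ∫ b, F γ a b ∂νB) νA) :
    ∫ a, ∫ b, ∑' γ, F γ a b ∂νB ∂νA = ∑' γ, ∫ a, ∫ b, F γ a b ∂νB ∂νA := by
  simp_rw [integral_tsum_of_dominated νB hd hm]
  symm
  refine integral_tsum_of_summable_integral_norm (fun γ => ?_) ?_
  · exact Integrable.of_bound (hmA γ) (c γ * (νB Set.univ).toReal)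
      (Eventually.of_forall fun a => norm_integral_le_of_dominated νB hd γ a)
  · refine ((hd.1.mul_right (νB Set.univ).toReal).mul_right (νA Set.univ).toReal).of_nonneg_of_le
      (fun γ => integral_nonneg fun a => norm_nonneg _) fun γ => ?_
    calc ∫ a, ‖∫ b, F γ a b ∂νB‖ ∂νA ≤ ∫ _a, c γ * (νB Set.univ).toReal ∂νA :=
          integral_mono_of_nonneg (Eventually.of_forall fun a => norm_nonneg _) (integrable_const _)
            (Eventually.of_forall fun a => norm_integral_le_of_dominated νB hd γ a)
      _ = c γ * (νB Set.univ).toReal * (νA Set.univ).toReal := by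
          rw [integral_const]
          simp [Measure.real, mul_comm]

end Summit.Ventures.HodgeRepro2.T7SupportDoublePeriodSeries
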